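import Summits.BirchSwinnertonDyer.BirchSwinnertonDyer.Theorems.ManinLocalTwoThreeNeronSqueeze
import Literature.NumberTheory.EllipticCurves.ManinConstantQuadraticTwistGamma0Proofs
import Literature.NumberTheory.EllipticCurves.ManinConstantQuadraticTwistStevensHoldsProofs
import Literature.NumberTheory.EllipticCurves.ManinConstantQuadraticTwistLimbProofs
import Literature.NumberTheory.EllipticCurves.GlobalMinimalModelProofs
import Literature.NumberTheory.EllipticCurves.ModularCurveNeronLatticeProofs
import Literature.NumberTheory.LFunctions.PrimitiveQuadraticCharacterGaussSum
import Literature.NumberTheory.EllipticCurves.RootNumberTwistProofs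
import HarnessLib

/-!
# The odd-twist transport of `|c| = 1` from a ROOT FORM — THEOREM 68.A without a root datum

Cell bsd-f2-manin, route `ManinLocalTwoThree` (cruxes C2 `ManinOddAtFour` stmt-BirchSwinnertonDyer-22967 / C3 `ManinPrimeToThreeAtNine`
stmt-BirchSwinnertonDyer-22968), prover seat p3 gen 26.

THE ENGINE of `…TwistFamiliesFactFree` (THEOREM 68.A, `abs_maninConstant_eq_one_of_twist`) ascends `|c| = 1` along the
`χ_p`-twist (`p` odd) from a lattice-optimal ROOT DATUM `D₀` on a globally minimal root curve: it therefore yields the C2/C3 shapes on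
the twist image of a fact-free level `M` only RELATIVE TO a root datum, i.e. modulo the existence of an `X₀(M)`-parametrisation of the
root class (modularity).  This file removes the datum: the only thing the chain uses of `D₀` is the inclusion `c₀·Λ(f₀) ⊆ Λ_{W₀}`, and
the fact-free root levels of the tree supply exactly such an inclusion for an EXPLICIT root form and an EXPLICIT globally minimal root
curve — p3's analytic squeezes `Λ(φ_M) ⊆ Λ_Néron(W₀)` (`periodLatticeLe_<level>`, the E₂ road / Bracket–Sturm certificates).

* §1 `periodLattice_le_of_rootForm_charTwist` — FORM LEVEL: `Λ(f₀) ⊆ Λ(L₀)` and `aₙ(g) = χ(n)·aₙ(f₀)` (`g` of level `N`, `M ∣ N`,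
  `m² ∣ N`, `χ` primitive quadratic mod `m`) give `Λ(g) ⊆ Λ(L')` for every pair `L'` with `Λ(L') = g(χ)⁻¹·Λ(L₀)`
  (the tree's `Γ₀` twisting theorem `gaussSum_mul_mem_periodLattice_of_mem_charTwist`, Stevens (5.4) / Shimura 3.64).
* §2 `abs_maninConstant_eq_one_of_rootForm_oddTwist` — THE TRANSPORT: `W₀/ℚ` globally minimal, good or multiplicative at the odd
  prime `p`, with Néron pair `L₀` and `Λ(f₀) ⊆ Λ(L₀)`; then every lattice-optimal `X₀(N)`-datum `D` (`M ∣ N`, `p² ∣ N`) on a globally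
  minimal curve with `aₙ(D.f) = χ(n)·aₙ(f₀)` has `|c(D)| = 1` — by §1 with `L' =` a Néron pair of a minimal model `C` of `W₀ ⊗ ℚ(√p*)`
  (Stevens' Lemma (5.2), PROVED in the tree as `stevens1989_neronLattice_quadraticTwist_oddPrime_holds`) and p3's Néron squeeze
  (`NeronSqueeze.abs_maninConstant_eq_one_of_periodLattice_le`).  Variants: `…_of_rootForm_charTwist_eq` (`D.f = charTwist N … f₀`),
  `not_dvd_maninConstant_of_rootForm_oddTwist` (no prime divides `c`).

HONEST FRAMING.  Unconditional (standard axioms); no modularity, no CDT, no printed Manin fact, no root datum.  It is an ENGINE: it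
proves `|c| = 1` on a `χ_p`-twist image only given the analytic squeeze of an explicit root form; nothing here proves C2, C3 (∀ N),
Manin's conjecture or BSD; items 22967/22968 stay OPEN.  No definition, no named fact, no sorry.
[cite: Stevens1989, Lemma (5.2) p. 96, Lemma (5.4) p. 97] [cite: Shimura1971, Prop. 3.64] [cite: AgasheRibetStein2006, §§1–2]
[cite: SilvermanATAEC1994, Cor. IV.9.1]
-/

set_option autoImplicit false
-- lint-debt: the directory name repeats the summit name (sibling precedent `ManinLocalTwoThreeTwistFamiliesFactFree.lean`)
set_option linter.dupNamespace false

noncomputable section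

open scoped MatrixGroups ModularForm
open CongruenceSubgroup WeierstrassCurve
open Literature.NumberTheory.EllipticCurves Literature.NumberTheory.EllipticCurves.ModularForms
open Literature.NumberTheory.LFunctions.PrimitiveQuadratic

namespace Summit.BirchSwinnertonDyer.BirchSwinnertonDyer.Theorems.ManinLocalTwoThree.OddTwistRootForm

/-! ## §1 Form level: the twisted period lattice lies in the rescaled root lattice -/

/-- **`Λ(g) ⊆ g(χ)⁻¹·Λ(L₀)` for a `χ`-twist `g` of a root form `f₀` with `Λ(f₀) ⊆ Λ(L₀)`.**  Here `g ∈ S₂(Γ₀(N))`, `f₀ ∈ S₂(Γ₀(M))`,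
`M ∣ N`, `m² ∣ N`, `χ` primitive quadratic mod `m`, `aₙ(g) = χ(n)·aₙ(f₀)` for all `n` (so `g = charTwist N … f₀` by the
`q`-expansion principle), and `L'` is any period pair with `z ∈ Λ(L') ↔ g(χ)·z ∈ Λ(L₀)`.
[cite: Stevens1989, Lemma (5.4) p. 97] [cite: Shimura1971, Prop. 3.64] -/
theorem periodLattice_le_of_rootForm_charTwist {M : ℕ} [NeZero M] {N : ℕ} [NeZero N] (hMN : M ∣ N)
    {m : ℕ} [NeZero m] (hmN : m ^ 2 ∣ N) {χ : DirichletCharacter ℂ m} (hχ : χ.IsQuadratic) (hprim : χ.IsPrimitive)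
    (f₀ : CuspForm (Gamma0 M) 2) (L₀ : PeriodPair) (hS0 : ∀ z ∈ periodLattice f₀, z ∈ L₀.lattice)
    (L' : PeriodPair) (hL' : ∀ z : ℂ, z ∈ L'.lattice ↔ gaussSum χ (ZMod.stdAddChar (N := m)) * z ∈ L₀.lattice)
    (g : CuspForm (Gamma0 N) 2) (hg : ∀ n : ℕ, cuspCoeff g n = χ n * cuspCoeff f₀ n) :
    ∀ z ∈ periodLattice g, z ∈ L'.lattice := by
  have hgeq : g = charTwist N hMN hmN hχ f₀ :=
    eq_of_forall_cuspCoeff_eq_gamma0 fun n ↦ by rw [hg, cuspCoeff_charTwist N hMN hmN hχ hprim]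
  intro z hz
  rw [hL']
  rw [hgeq] at hz
  exact hS0 _ (gaussSum_mul_mem_periodLattice_of_mem_charTwist N hMN hmN hχ hprim f₀ hz)

/-! ## §2 The transport of `|c| = 1` along an odd prime twist, from a root form -/

/-- **THEOREM 68.A WITHOUT A ROOT DATUM — `|c| = 1` on the `χ_p`-twist image of an explicit root form.**  `p` an odd prime, `χ`
primitive quadratic mod `p`; `f₀ ∈ S₂(Γ₀(M))`; `W₀/ℚ` globally minimal elliptic, good or multiplicative at `p`, with Néron pair `L₀`
and the analytic squeeze `Λ(f₀) ⊆ Λ(L₀)`; `W/ℚ` globally minimal elliptic with an `X₀(N)`-datum `D` (`M ∣ N`, `p² ∣ N`) satisfying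
`aₙ(D.f) = χ(n)·aₙ(f₀)` and the lattice clause `Λ_W = c·Λ(D.f)`.  Then `|c| = 1`.  Chain: `χ = (·/p)`, `g(χ)² = p*`; a minimal
model `C` of `W₀ ⊗ ℚ(√p*)` with Néron pair `L_C`, `Λ(L_C) = g(χ)⁻¹Λ(L₀)` (Stevens (5.2), PROVED); §1 gives `Λ(D.f) ⊆ Λ(L_C)`; the
Néron squeeze with the globally minimal `C`.  No modularity, no CDT, no printed fact.
[cite: Stevens1989, Lemma (5.2) p. 96, Lemma (5.4) p. 97] [cite: AgasheRibetStein2006, §§1–2] [cite: SilvermanATAEC1994, Cor. IV.9.1] -/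
theorem abs_maninConstant_eq_one_of_rootForm_oddTwist {p : ℕ} [Fact p.Prime] (hp2 : p ≠ 2)
    {χ : DirichletCharacter ℂ p} (hχ : χ.IsQuadratic) (hprim : χ.IsPrimitive)
    {M : ℕ} [NeZero M] (f₀ : CuspForm (Gamma0 M) 2)
    (W₀ : WeierstrassCurve ℚ) [W₀.IsElliptic] [W₀.IsGloballyMinimal] (L₀ : PeriodPair)
    (hL₀ : IsNeronLatticeOf (W₀.baseChange ℂ) L₀) (hS0 : ∀ z ∈ periodLattice f₀, z ∈ L₀.lattice)
    (hsemi : W₀.HasGoodReductionAtPrime p ∨ W₀.HasMultiplicativeReductionAtPrime p)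
    (W : WeierstrassCurve ℚ) [W.IsElliptic] [W.IsGloballyMinimal] {N : ℕ} [NeZero N]
    (D : ModularParametrizationData W N) (hMN : M ∣ N) (hpN : p ^ 2 ∣ N)
    (hf : ∀ n : ℕ, cuspCoeff D.f n = χ n * cuspCoeff f₀ n)
    (hopt : ∀ z ∈ D.L.lattice, ∃ w ∈ periodLattice D.f, z = D.c * w) :
    |D.maninConstant| = 1 := by
  have hpP : p.Prime := Fact.out
  haveI : NeZero p := ⟨hpP.ne_zero⟩
  have hodd : Odd p := hpP.odd_of_ne_two hp2
  -- the character is the Legendre character, so `g(χ)² = p*`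
  have hχeq : χ = (quadraticChar (ZMod p)).ringHomComp (Int.castRingHom ℂ) := by
    rw [eq_jacobiChar_of_odd hodd hprim hχ,
      eq_jacobiChar_of_odd hodd (isPrimitive_quadraticChar_ringHomComp p hp2)
        (isQuadratic_quadraticChar_ringHomComp p)]
  have hG : gaussSum χ (ZMod.stdAddChar (N := p)) ^ 2 = (((-1 : ℤ) ^ (p / 2) * p : ℤ) : ℂ) := by
    rw [hχeq]; exact gaussSum_quadraticChar_ringHomComp_sq p hp2
  -- a minimal model `C` of `W₀ ⊗ ℚ(√p*)` and a Néron pair of it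
  have hd0 : ((((-1 : ℤ) ^ (p / 2) * p : ℤ)) : ℚ) ≠ 0 := by
    push_cast
    exact mul_ne_zero (pow_ne_zero _ (by norm_num)) (by exact_mod_cast hpP.ne_zero)
  haveI : (W₀.quadraticTwist (((-1 : ℤ) ^ (p / 2) * p : ℤ) : ℚ)).IsElliptic := W₀.isElliptic_quadraticTwist hd0
  obtain ⟨vC, hvC⟩ := hasGlobalMinimalModel_rat_holds (W₀.quadraticTwist (((-1 : ℤ) ^ (p / 2) * p : ℤ) : ℚ))
  haveI := hvC
  haveI : ((vC • W₀.quadraticTwist (((-1 : ℤ) ^ (p / 2) * p : ℤ) : ℚ)).baseChange ℂ).IsElliptic := by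
    rw [WeierstrassCurve.baseChange]; infer_instance
  obtain ⟨LC, hC⟩ := exists_isNeronLatticeOf_holds ((vC • W₀.quadraticTwist (((-1 : ℤ) ^ (p / 2) * p : ℤ) : ℚ)).baseChange ℂ)
  -- Stevens (5.2): `Λ(L_C) = g(χ)⁻¹ Λ(L₀)`
  have hLC : ∀ z : ℂ, z ∈ LC.lattice ↔ gaussSum χ (ZMod.stdAddChar (N := p)) * z ∈ L₀.lattice :=
    stevens1989_neronLattice_quadraticTwist_oddPrime_holds W₀ L₀ hL₀ p hp2 hsemi _ ⟨vC, rfl⟩ LC hC _ hG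
  -- §1: `Λ(D.f) ⊆ Λ(L_C)`; then the Néron squeeze with the globally minimal `C`
  have hS2 : ∀ z ∈ periodLattice D.f, z ∈ LC.lattice :=
    periodLattice_le_of_rootForm_charTwist hMN hpN hχ hprim f₀ L₀ hS0 LC hLC D.f hf
  exact NeronSqueeze.abs_maninConstant_eq_one_of_periodLattice_le
    (vC • W₀.quadraticTwist (((-1 : ℤ) ^ (p / 2) * p : ℤ) : ℚ)) LC hC W D hS2 hopt

/-- **The same with the twist relation in `charTwist` form**: `D.f = (f₀) ⊗ χ` at level `N`.
[cite: Stevens1989, Lemma (5.2) p. 96, Lemma (5.4) p. 97] -/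
theorem abs_maninConstant_eq_one_of_rootForm_charTwist_eq {p : ℕ} [Fact p.Prime] (hp2 : p ≠ 2)
    {χ : DirichletCharacter ℂ p} (hχ : χ.IsQuadratic) (hprim : χ.IsPrimitive)
    {M : ℕ} [NeZero M] (f₀ : CuspForm (Gamma0 M) 2)
    (W₀ : WeierstrassCurve ℚ) [W₀.IsElliptic] [W₀.IsGloballyMinimal] (L₀ : PeriodPair)
    (hL₀ : IsNeronLatticeOf (W₀.baseChange ℂ) L₀) (hS0 : ∀ z ∈ periodLattice f₀, z ∈ L₀.lattice)
    (hsemi : W₀.HasGoodReductionAtPrime p ∨ W₀.HasMultiplicativeReductionAtPrime p)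
    (W : WeierstrassCurve ℚ) [W.IsElliptic] [W.IsGloballyMinimal] {N : ℕ} [NeZero N]
    (D : ModularParametrizationData W N) (hMN : M ∣ N) (hpN : p ^ 2 ∣ N)
    (hf : D.f = charTwist N hMN hpN hχ f₀)
    (hopt : ∀ z ∈ D.L.lattice, ∃ w ∈ periodLattice D.f, z = D.c * w) :
    |D.maninConstant| = 1 :=
  haveI : NeZero p := ⟨(Fact.out : p.Prime).ne_zero⟩
  abs_maninConstant_eq_one_of_rootForm_oddTwist hp2 hχ hprim f₀ W₀ L₀ hL₀ hS0 hsemi W D hMN hpN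
    (fun n ↦ by rw [hf, cuspCoeff_charTwist N hMN hpN hχ hprim]) hopt

/-- **Corollary: no integer `q` with `|q| ≠ 1` — in particular no prime — divides the Manin constant** of such a datum.
[cite: Stevens1989, Lemma (5.2) p. 96, Lemma (5.4) p. 97] [cite: AgasheRibetStein2006, §§1–2] -/
theorem not_dvd_maninConstant_of_rootForm_oddTwist {p : ℕ} [Fact p.Prime] (hp2 : p ≠ 2)
    {χ : DirichletCharacter ℂ p} (hχ : χ.IsQuadratic) (hprim : χ.IsPrimitive)
    {M : ℕ} [NeZero M] (f₀ : CuspForm (Gamma0 M) 2)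
    (W₀ : WeierstrassCurve ℚ) [W₀.IsElliptic] [W₀.IsGloballyMinimal] (L₀ : PeriodPair)
    (hL₀ : IsNeronLatticeOf (W₀.baseChange ℂ) L₀) (hS0 : ∀ z ∈ periodLattice f₀, z ∈ L₀.lattice)
    (hsemi : W₀.HasGoodReductionAtPrime p ∨ W₀.HasMultiplicativeReductionAtPrime p)
    (W : WeierstrassCurve ℚ) [W.IsElliptic] [W.IsGloballyMinimal] {N : ℕ} [NeZero N]
    (D : ModularParametrizationData W N) (hMN : M ∣ N) (hpN : p ^ 2 ∣ N)
    (hf : ∀ n : ℕ, cuspCoeff D.f n = χ n * cuspCoeff f₀ n)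
    (hopt : ∀ z ∈ D.L.lattice, ∃ w ∈ periodLattice D.f, z = D.c * w)
    {q : ℤ} (hq : q.natAbs ≠ 1) : ¬ q ∣ D.maninConstant := by
  intro h
  have h1 := abs_maninConstant_eq_one_of_rootForm_oddTwist hp2 hχ hprim f₀ W₀ L₀ hL₀ hS0 hsemi W D hMN hpN hf hopt
  have hn : D.maninConstant.natAbs = 1 := by
    rw [Int.abs_eq_natAbs] at h1
    exact_mod_cast h1
  have h2 : q.natAbs ∣ 1 := hn ▸ Int.natAbs_dvd_natAbs.mpr h
  exact hq (Nat.dvd_one.mp h2)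

end Summit.BirchSwinnertonDyer.BirchSwinnertonDyer.Theorems.ManinLocalTwoThree.OddTwistRootForm

end
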